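import Summits.NavierStokesRegularity.TurbBounds.IntervalLemma
import HarnessLib

/-!
# Interval lemmas R-I (bottom form) and R-I′ (tangent pair with UNEQUAL Young weights) — companions of `IntervalLemma.lean`
(cell `pub-turb` / `turb-bounds`; file of record `HOME/CERT-RB.md` §R: R-I data-driven form + the referee-authored addendum R-I′,
`tribunal/t-lemmas.md` pass 3; producer of this file pub-turb-sos = planner-pub-turb-sos-g6-0, task T12 / LEAN-MAP §1–§2.)

HONEST FRAMING: rigorous bounds for the stated PDE and boundary conditions; no claim about physical turbulence beyond the bound.
This file contains NO fluid mechanics: two finite-dimensional facts used by the row evaluators `Certs/<Row>/Evaluator.lean` to pass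
from finitely many exact PSD certificates to the wavenumber CONTINUUM.

1. `posSemidef_pencil_on_bottom` ('bottom' data of kint / p2cert, `(u, v) = (1/Kb, 0)`): if both pencil coefficients `A, B ⪰ 0` and
   `M(1/Kb, 0) ⪰ 0` then `M(1/K, K) ⪰ 0` for every `0 < K ≤ Kb`.
2. `pencil_on_interval_tangent_mixed` (**lemma R-I′**): the pencil now also carries the Young-weight terms `−(Tε)•XW − (T/ε)•XT` with
   `XT ⪰ 0`. If the two endpoint matrices of a 'tangent' pair are PSD at POSSIBLY DIFFERENT weights `ε₁, ε₂ > 0` and the two scalar tail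
   conditions hold at both endpoints, then for every `K ∈ [Ka, Kb]` SOME real weight `ε > 0` (the matching convex combination of `ε₁, ε₂`)
   makes `M(1/K, K; ε) ⪰ 0` with both scalar conditions — convexity of the PSD cone along the tangent data path (`tangent_le_inv`,
   IntervalLemma.lean), `A ⪰ 0`, and the mixing inequality `1/ε ≤ (1−t)/ε₁ + t/ε₂` (convexity of `x ↦ 1/x`) paid for by `XT ⪰ 0`.
   With `ε₁ = ε₂` it is the tangent form of R-I plus bookkeeping of the two scalars.
-/

set_option linter.style.longLine false

namespace Summit.NavierStokesRegularity.TurbBounds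

open Matrix

/-- The 'bottom' companion of the interval lemma R-I (CERT-RB §R; kint 'bottom' data `(u, v) = (1/Kb, 0)` serves `0 < K ≤ Kb`):
if both pencil coefficients are positive semidefinite and the ONE matrix `M(1/Kb, 0)` is, then `M(1/K, K)` is positive
semidefinite for every `0 < K ≤ Kb`, because `M(1/K, K) = M(1/Kb, 0) + (1/K − 1/Kb)•A + K•B` with nonnegative coefficients. -/
theorem posSemidef_pencil_on_bottom {n : Type*} [Fintype n] (M₀ A B : Matrix n n ℝ) (hA : A.PosSemidef) (hB : B.PosSemidef)
    {Kb : ℝ} (h : (M₀ + (1 / Kb) • A + (0 : ℝ) • B).PosSemidef) :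
    ∀ K, 0 < K → K ≤ Kb → (M₀ + (1 / K) • A + K • B).PosSemidef := by
  intro K hK hKb'
  have hdecomp : M₀ + (1 / K) • A + K • B
      = (M₀ + (1 / Kb) • A + (0 : ℝ) • B) + (1 / K - 1 / Kb) • A + K • B := by
    ext i j
    simp only [Matrix.add_apply, Matrix.smul_apply, smul_eq_mul]
    ring
  rw [hdecomp]
  have hu : 0 ≤ 1 / K - 1 / Kb := by
    rw [sub_nonneg]; exact one_div_le_one_div_of_le hK hKb'
  exact (h.add (hA.smul hu)).add (hB.smul hK.le)

/-- **Lemma R-I′** (CERT-RB §R, referee-authored addendum, tribunal/t-lemmas.md pass 3; here with the scalar tail conditions included).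
Pencils `M(u, v; ε) = Mb + u•A + v•B − (Tε)•XW − (T/ε)•XT` with `A ⪰ 0`, `XT ⪰ 0`, `T ≥ 0`. If the 'tangent' endpoint matrices
`M((2Kb−Ka)/Kb², Ka; ε₁)` and `M(1/Kb, Kb; ε₂)` are positive semidefinite with POSSIBLY DIFFERENT Young weights `ε₁, ε₂ > 0`, and the
W- and Θ-tail scalars are nonnegative at both endpoint data, then for every `K ∈ [Ka, Kb]` there is a Young weight `ε > 0` (namely
`ε = (1−t)ε₁ + tε₂`, `K = (1−t)Ka + tKb`) at which `M(1/K, K; ε) ⪰ 0` AND both tail scalars are nonnegative at `(1/K, ε)`. Proof: the convex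
combination of the endpoint matrices equals `Mb + ℓ(K)•A + K•B − (Tε)•XW − (T·h)•XT` with `ℓ` the tangent line of `1/K` at `Kb` (`≤ 1/K`,
`tangent_le_inv`) and `h = (1−t)/ε₁ + t/ε₂ ≥ 1/ε` (convexity of `1/x`: `εh − 1 = t(1−t)(ε₁−ε₂)²/(ε₁ε₂)`); add `(1/K − ℓ(K))•A ⪰ 0` and
`T(h − 1/ε)•XT ⪰ 0`. The W-scalar `16u·a − Tελ_W` is affine along the path and increasing in `u`; the Θ-scalar gains `Tλ_T(h − 1/ε) ≥ 0`. -/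
theorem pencil_on_interval_tangent_mixed {n : Type*} [Fintype n] (Mb A B XW XT : Matrix n n ℝ)
    (hA : A.PosSemidef) (hXT : XT.PosSemidef) {T a s lW lT Ka Kb ε₁ ε₂ : ℝ} (hT : 0 ≤ T) (ha : 0 ≤ a) (hTl : 0 ≤ T * lT)
    (hKa : 0 < Ka) (hab : Ka ≤ Kb) (he₁ : 0 < ε₁) (he₂ : 0 < ε₂)
    (h1 : (Mb + ((2 * Kb - Ka) / Kb ^ 2) • A + Ka • B + (-(T * ε₁)) • XW + (-(T / ε₁)) • XT).PosSemidef)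
    (h2 : (Mb + (1 / Kb) • A + Kb • B + (-(T * ε₂)) • XW + (-(T / ε₂)) • XT).PosSemidef)
    (hW1 : 0 ≤ 16 * ((2 * Kb - Ka) / Kb ^ 2) * a - T * ε₁ * lW) (hW2 : 0 ≤ 16 * (1 / Kb) * a - T * ε₂ * lW)
    (hT1 : 0 ≤ 4 * s - T * lT / ε₁) (hT2 : 0 ≤ 4 * s - T * lT / ε₂) :
    ∀ K, Ka ≤ K → K ≤ Kb → ∃ ε : ℝ, 0 < ε ∧
      (Mb + (1 / K) • A + K • B + (-(T * ε)) • XW + (-(T / ε)) • XT).PosSemidef ∧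
      0 ≤ 16 * (1 / K) * a - T * ε * lW ∧ 0 ≤ 4 * s - T * lT / ε := by
  intro K hK1 hK2
  have hKb : 0 < Kb := lt_of_lt_of_le hKa hab
  have hK : 0 < K := lt_of_lt_of_le hKa hK1
  rcases eq_or_lt_of_le hab with heq | hlt
  · -- degenerate interval: K = Kb, the right endpoint block itself
    have hKeq : K = Kb := le_antisymm hK2 (heq ▸ hK1)
    subst hKeq
    exact ⟨ε₂, he₂, h2, hW2, hT2⟩
  · set t : ℝ := (K - Ka) / (Kb - Ka) with ht
    have hden : 0 < Kb - Ka := sub_pos.mpr hlt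
    have ht0 : 0 ≤ t := div_nonneg (sub_nonneg.mpr hK1) hden.le
    have ht1 : t ≤ 1 := by
      rw [ht, div_le_one hden]; linarith
    have hKt : K = (1 - t) * Ka + t * Kb := by
      rw [ht]; field_simp; ring
    set ε : ℝ := (1 - t) * ε₁ + t * ε₂ with hε
    have hεpos : 0 < ε := by
      by_cases hc : ε₁ ≤ ε₂
      · nlinarith [mul_nonneg ht0 (sub_nonneg.mpr hc)]
      · nlinarith [mul_nonneg (sub_nonneg.mpr ht1) (sub_nonneg.mpr (not_le.mp hc).le)]
    -- convexity of 1/x: 1/ε ≤ (1−t)/ε₁ + t/ε₂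
    have hconv : 1 / ε ≤ (1 - t) / ε₁ + t / ε₂ := by
      rw [div_le_iff₀ hεpos]
      have key : ((1 - t) / ε₁ + t / ε₂) * ε - 1 = t * (1 - t) * (ε₁ - ε₂) ^ 2 / (ε₁ * ε₂) := by
        rw [hε]; field_simp; ring
      have hnum : 0 ≤ t * (1 - t) * (ε₁ - ε₂) ^ 2 / (ε₁ * ε₂) :=
        div_nonneg (mul_nonneg (mul_nonneg ht0 (sub_nonneg.mpr ht1)) (sq_nonneg _)) (mul_pos he₁ he₂).le
      linarith
    -- the convex combination of the two endpoint matrices is PSD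
    have hpath := (h1.smul (sub_nonneg.mpr ht1)).add (h2.smul ht0)
    -- the interpolated u-datum is the tangent line of 1/K at Kb, evaluated at K, hence ≤ 1/K
    have hℓ : (1 - t) * ((2 * Kb - Ka) / Kb ^ 2) + t * (1 / Kb) ≤ 1 / K := by
      have e : (1 - t) * ((2 * Kb - Ka) / Kb ^ 2) + t * (1 / Kb) = (2 * Kb - K) / Kb ^ 2 := by
        rw [hKt]; field_simp; ring
      rw [e]; exact tangent_le_inv hKb hK
    have hdecomp : Mb + (1 / K) • A + K • B + (-(T * ε)) • XW + (-(T / ε)) • XT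
        = ((1 - t) • (Mb + ((2 * Kb - Ka) / Kb ^ 2) • A + Ka • B + (-(T * ε₁)) • XW + (-(T / ε₁)) • XT)
            + t • (Mb + (1 / Kb) • A + Kb • B + (-(T * ε₂)) • XW + (-(T / ε₂)) • XT))
          + (1 / K - ((1 - t) * ((2 * Kb - Ka) / Kb ^ 2) + t * (1 / Kb))) • A
          + (T * ((1 - t) / ε₁ + t / ε₂ - 1 / ε)) • XT := by
      ext i j
      simp only [Matrix.add_apply, Matrix.smul_apply, smul_eq_mul]
      rw [hε, hKt]
      ring
    refine ⟨ε, hεpos, ?_, ?_, ?_⟩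
    · rw [hdecomp]
      exact (hpath.add (hA.smul (sub_nonneg.mpr hℓ))).add (hXT.smul (mul_nonneg hT (sub_nonneg.mpr hconv)))
    · have e1 : 0 ≤ (1 - t) * (16 * ((2 * Kb - Ka) / Kb ^ 2) * a - T * ε₁ * lW) := mul_nonneg (sub_nonneg.mpr ht1) hW1
      have e2 : 0 ≤ t * (16 * (1 / Kb) * a - T * ε₂ * lW) := mul_nonneg ht0 hW2
      have e3 : 0 ≤ a * (1 / K - ((1 - t) * ((2 * Kb - Ka) / Kb ^ 2) + t * (1 / Kb))) := mul_nonneg ha (sub_nonneg.mpr hℓ)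
      have eq : 16 * (1 / K) * a - T * ε * lW = (1 - t) * (16 * ((2 * Kb - Ka) / Kb ^ 2) * a - T * ε₁ * lW)
          + t * (16 * (1 / Kb) * a - T * ε₂ * lW) + 16 * (a * (1 / K - ((1 - t) * ((2 * Kb - Ka) / Kb ^ 2) + t * (1 / Kb)))) := by
        rw [hε]; ring
      rw [eq]
      exact add_nonneg (add_nonneg e1 e2) (mul_nonneg (by norm_num) e3)
    · have e1 : 0 ≤ (1 - t) * (4 * s - T * lT / ε₁) := mul_nonneg (sub_nonneg.mpr ht1) hT1
      have e2 : 0 ≤ t * (4 * s - T * lT / ε₂) := mul_nonneg ht0 hT2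
      have e3 : 0 ≤ (T * lT) * ((1 - t) / ε₁ + t / ε₂ - 1 / ε) := mul_nonneg hTl (sub_nonneg.mpr hconv)
      have eq : 4 * s - T * lT / ε = (1 - t) * (4 * s - T * lT / ε₁) + t * (4 * s - T * lT / ε₂)
          + (T * lT) * ((1 - t) / ε₁ + t / ε₂ - 1 / ε) := by ring
      rw [eq]
      exact add_nonneg (add_nonneg e1 e2) e3

end Summit.NavierStokesRegularity.TurbBounds
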